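import Summits.QuantumFields.GaugeBoot.Rows.GLYZc1D3HTab
import HarnessLib

/-!
# Gauge-boot: kernel check of the `H` class table, rows 66–84 (part 4/4)

Cell `pub-gaugeboot` (HOME `run/shared/lean/pub/pub-gaugeboot/`), seat lean1 (binding layer for rows C3–C14).

HONEST FRAMING (page 1 of every file of this cell): certified bounds on lattice expectations at STATED coupling,
gauge group, dimension and torus size; NOT a mass gap, NOT a continuum limit, NOT a string tension, NOT large `N`.
The venture is explicitly NOT Yang–Mills-summit-bearing (barriers `FixedCouplingUltralocality`,
`PerturbativeInvisibility`).

`hcanon_row_i : ∀ j, HCanonOK i j` for `i = 66 … 84`, each one closed computation (`decide +kernel`).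
The table is assembled in `GLYZc1D3Canon`.
-/

noncomputable section

open Literature.MathematicalPhysics.QuantumFieldTheory

namespace Summit.QuantumFields.GaugeBoot

namespace GLYZc1D3

/-- Row `66` of the `H` class table canonicalises (closed computation checked by the kernel). -/
theorem hcanon_row_66 : ∀ j : Fin 85, HCanonOK 66 j := by decide +kernel
/-- Row `67` of the `H` class table canonicalises (closed computation checked by the kernel). -/
theorem hcanon_row_67 : ∀ j : Fin 85, HCanonOK 67 j := by decide +kernel
/-- Row `68` of the `H` class table canonicalises (closed computation checked by the kernel). -/
theorem hcanon_row_68 : ∀ j : Fin 85, HCanonOK 68 j := by decide +kernel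
/-- Row `69` of the `H` class table canonicalises (closed computation checked by the kernel). -/
theorem hcanon_row_69 : ∀ j : Fin 85, HCanonOK 69 j := by decide +kernel
/-- Row `70` of the `H` class table canonicalises (closed computation checked by the kernel). -/
theorem hcanon_row_70 : ∀ j : Fin 85, HCanonOK 70 j := by decide +kernel
/-- Row `71` of the `H` class table canonicalises (closed computation checked by the kernel). -/
theorem hcanon_row_71 : ∀ j : Fin 85, HCanonOK 71 j := by decide +kernel
/-- Row `72` of the `H` class table canonicalises (closed computation checked by the kernel). -/
theorem hcanon_row_72 : ∀ j : Fin 85, HCanonOK 72 j := by decide +kernel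
/-- Row `73` of the `H` class table canonicalises (closed computation checked by the kernel). -/
theorem hcanon_row_73 : ∀ j : Fin 85, HCanonOK 73 j := by decide +kernel
/-- Row `74` of the `H` class table canonicalises (closed computation checked by the kernel). -/
theorem hcanon_row_74 : ∀ j : Fin 85, HCanonOK 74 j := by decide +kernel
/-- Row `75` of the `H` class table canonicalises (closed computation checked by the kernel). -/
theorem hcanon_row_75 : ∀ j : Fin 85, HCanonOK 75 j := by decide +kernel
/-- Row `76` of the `H` class table canonicalises (closed computation checked by the kernel). -/
theorem hcanon_row_76 : ∀ j : Fin 85, HCanonOK 76 j := by decide +kernel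
/-- Row `77` of the `H` class table canonicalises (closed computation checked by the kernel). -/
theorem hcanon_row_77 : ∀ j : Fin 85, HCanonOK 77 j := by decide +kernel
/-- Row `78` of the `H` class table canonicalises (closed computation checked by the kernel). -/
theorem hcanon_row_78 : ∀ j : Fin 85, HCanonOK 78 j := by decide +kernel
/-- Row `79` of the `H` class table canonicalises (closed computation checked by the kernel). -/
theorem hcanon_row_79 : ∀ j : Fin 85, HCanonOK 79 j := by decide +kernel
/-- Row `80` of the `H` class table canonicalises (closed computation checked by the kernel). -/
theorem hcanon_row_80 : ∀ j : Fin 85, HCanonOK 80 j := by decide +kernel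
/-- Row `81` of the `H` class table canonicalises (closed computation checked by the kernel). -/
theorem hcanon_row_81 : ∀ j : Fin 85, HCanonOK 81 j := by decide +kernel
/-- Row `82` of the `H` class table canonicalises (closed computation checked by the kernel). -/
theorem hcanon_row_82 : ∀ j : Fin 85, HCanonOK 82 j := by decide +kernel
/-- Row `83` of the `H` class table canonicalises (closed computation checked by the kernel). -/
theorem hcanon_row_83 : ∀ j : Fin 85, HCanonOK 83 j := by decide +kernel
/-- Row `84` of the `H` class table canonicalises (closed computation checked by the kernel). -/
theorem hcanon_row_84 : ∀ j : Fin 85, HCanonOK 84 j := by decide +kernel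

end GLYZc1D3

end Summit.QuantumFields.GaugeBoot

end
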